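import Mathlib
import Literature.Analysis.Convex.SchauderFixedPoint
import HarnessLib

/-!
# Ky Fan's minimax inequality and von Neumann's minimax theorem (Aubin, *Optima and Equilibria*, Ch. 8)

Literature anchor for J.-P. Aubin, *Optima and Equilibria: An Introduction to Nonlinear Analysis*,
GTM 140, Springer 1993 (2nd ed. 1998) [Aubin1993], Chapter 8 "Two-person Zero-sum Games: Theorems of
Von Neumann and Ky Fan".

* `exists_forall_le` — **Thm 8.6 (Ky Fan's Inequality)** in threshold form: `K` nonempty convex compact,
  `x ↦ f x y` lower semicontinuous on `K` for every `y ∈ K`, `y ↦ f x y` concave on `K` for every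
  `x ∈ K`, and `f y y ≤ t` on the diagonal `⟹ ∃ x̄ ∈ K, ∀ y ∈ K, f x̄ y ≤ t`. (Aubin states the
  conclusion as `sup_y f(x̄, y) ≤ sup_y f(y, y)`; with `t := sup_y f(y, y)` this is the same statement
  whenever that supremum is finite, and vacuous otherwise — the threshold form avoids `sSup` on `ℝ`.)
  The proof is the "direct proof based on the Brouwer Fixed-Point Theorem" of the Remark on
  pp. 141–142: if every `x` has a `y` with `f x y > t`, finitely many of the (relatively open) sets
  `{x | f x yᵢ > t}` cover `K`; a continuous partition of unity `αᵢ` gives the continuous map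
  `c x := Σ αᵢ(x) yᵢ` of `K` into itself, a fixed point `ȳ = c ȳ` (Schauder/Brouwer, tree file
  `SchauderFixedPoint`), and concavity gives `f ȳ ȳ ≥ Σ αᵢ(ȳ) f ȳ yᵢ > t`, a contradiction.
  Aubin works in a Hilbert space; the argument, and this file, only need a real normed space.
* `exists_forall_le_zero` — the usual normalisation `f y y ≤ 0 ⟹ ∃ x̄, ∀ y, f x̄ y ≤ 0`.
* `exists_isSaddlePoint` — **Thm 8.2 (von Neumann)**: `E`, `F` nonempty convex compact, `f` convex and
  lower semicontinuous in `x`, concave and upper semicontinuous in `y` `⟹` a saddle point exists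
  (derived here from Ky Fan's inequality on `E × F` applied to `φ((x,y),(x',y')) = f x y' - f x' y`;
  Aubin proves Thms 8.1/8.2 by separation).
* `exists_isSaddlePoint_matrixGame` — **Cor 8.1**: every finite zero-sum matrix game has a saddle
  point in mixed strategies (`stdSimplex`).

Relation to `Literature.Analysis.Convex.MinMax` (tree): that file proves von Neumann's 1928 min-max
theorem for FINITE matrix games in value form (`MinMax.exists_mixed_of_forall_mixed(_lt)`: "if every
mixed row strategy admits a pure column with payoff `≥ v`, some mixed column strategy has payoff
`≥ v` against every row"), directly from separation in `ℝ^I`. The present file is about the general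
theorems (Ky Fan's inequality and von Neumann's theorem for convex–concave semicontinuous functions
on compact convex sets of normed spaces); `exists_isSaddlePoint_matrixGame` is only the saddle-point
form of the finite case, recorded as the corollary Aubin draws (Cor 8.1). Neither file imports the
other.

Everything is proved; no definitions besides the transparent abbreviation `matrixGame`, no named
facts, no `sorry`. Related tree files: `SchauderFixedPoint.lean` (Brouwer/Schauder), `MinMax.lean`
(finite games, value form), `SetValuedEquilibria.lean` (Ch. 9 of the same book).
-/

open Set Metric Filter Topology

namespace Literature.Analysis.Convex.KyFanInequality

variable {X : Type*} [NormedAddCommGroup X] [NormedSpace ℝ X]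

/-! ## Ky Fan's inequality -/

/-- **Ky Fan's Inequality (Aubin Thm 8.6), threshold form.** `K` a nonempty convex compact subset of
a real normed space, `f : X → X → ℝ` with `x ↦ f x y` lower semicontinuous on `K` (`y ∈ K`) and
`y ↦ f x y` concave on `K` (`x ∈ K`). If `f y y ≤ t` for all `y ∈ K`, then some `x̄ ∈ K` satisfies
`f x̄ y ≤ t` for every `y ∈ K`. Proof by contradiction via a partition of unity and the
Brouwer–Schauder fixed point theorem (Aubin, Remark pp. 141–142).
[cite: Aubin1993, Thm 8.6 (Ky Fan's Inequality)] -/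
theorem exists_forall_le {K : Set X} (hKc : IsCompact K) (hKconv : Convex ℝ K) (hKne : K.Nonempty)
    {f : X → X → ℝ} (hlsc : ∀ y ∈ K, LowerSemicontinuousOn (fun x => f x y) K)
    (hconc : ∀ x ∈ K, ConcaveOn ℝ K (f x)) {t : ℝ} (ht : ∀ y ∈ K, f y y ≤ t) :
    ∃ x ∈ K, ∀ y ∈ K, f x y ≤ t := by
  classical
  by_contra H
  push Not at H
  -- for every `x ∈ K` a `y x ∈ K` with `t < f z (y x)` for `z ∈ K` near `x`
  have hsep : ∀ x, ∃ y : X, ∃ δ : ℝ, y ∈ K ∧ 0 < δ ∧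
      (x ∈ K → ∀ z ∈ K, dist z x < δ → t < f z y) := by
    intro x
    by_cases hx : x ∈ K
    · obtain ⟨y, hy, hty⟩ := H x hx
      have hev : ∀ᶠ z in 𝓝[K] x, t < f z y := (hlsc y hy x hx) t hty
      obtain ⟨δ, hδ, hδU⟩ := Metric.mem_nhdsWithin_iff.1 hev
      exact ⟨y, δ, hy, hδ, fun _ z hz hzx => hδU ⟨mem_ball.2 hzx, hz⟩⟩
    · obtain ⟨y, hy⟩ := hKne
      exact ⟨y, 1, hy, one_pos, fun h => absurd h hx⟩
  choose y δ hyK hδpos hprop using hsep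
  -- a finite subcover of `K` by the balls `ball x (δ x)` with centres in `K`
  obtain ⟨T, hTK, hcover⟩ := hKc.elim_nhds_subcover (fun x => ball x (δ x))
    (fun x _ => ball_mem_nhds x (hδpos x))
  have hcov : ∀ z ∈ K, ∃ i ∈ T, dist z i < δ i := fun z hz => by
    simpa only [mem_iUnion, mem_ball, exists_prop] using hcover hz
  -- partition of unity and the continuous self-map `c` of `K`
  set wt : X → X → ℝ := fun i z => max 0 (δ i - dist z i) with hwt
  have hwt_nonneg : ∀ i z, 0 ≤ wt i z := fun i z => le_max_left _ _
  have hwt_cont : ∀ i, Continuous (wt i) := fun i =>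
    continuous_const.max (continuous_const.sub (continuous_id.dist continuous_const))
  have hwt_pos_iff : ∀ i z, 0 < wt i z ↔ dist z i < δ i := fun i z => by
    simp only [hwt, lt_max_iff, lt_self_iff_false, false_or, sub_pos]
  have hsum_pos : ∀ z ∈ K, 0 < ∑ i ∈ T, wt i z := fun z hz => by
    obtain ⟨i₀, hi₀, hzi₀⟩ := hcov z hz
    exact Finset.sum_pos' (fun i _ => hwt_nonneg i z) ⟨i₀, hi₀, (hwt_pos_iff i₀ z).2 hzi₀⟩
  set c : X → X := fun z => T.centerMass (fun i => wt i z) y with hc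
  have hc_eq : c = fun z => (∑ i ∈ T, wt i z)⁻¹ • ∑ i ∈ T, wt i z • y i := rfl
  have hc_cont : ContinuousOn c K := by
    rw [hc_eq]
    refine ContinuousOn.smul ?_ ?_
    · exact (continuous_finsetSum _ fun i _ => hwt_cont i).continuousOn.inv₀
        fun z hz => (hsum_pos z hz).ne'
    · exact (continuous_finsetSum _ fun i _ => (hwt_cont i).smul continuous_const).continuousOn
  have hmaps : MapsTo c K K := fun z hz =>
    hKconv.centerMass_mem (fun i _ => hwt_nonneg i z) (hsum_pos z hz) fun i hi => hyK i
  obtain ⟨yb, hybK, hfix⟩ :=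
    exists_fixedPoint_of_mapsTo_isCompact hKconv hKc.isClosed hKne hKc hc_cont hmaps hmaps
  -- concavity at the fixed point
  have hjensen := (hconc yb hybK).le_map_centerMass (t := T) (w := fun i => wt i yb) (p := y)
    (fun i _ => hwt_nonneg i yb) (hsum_pos yb hybK) fun i _ => hyK i
  have hcfix : T.centerMass (fun i => wt i yb) y = yb := hfix
  rw [hcfix] at hjensen
  -- the averaged values exceed `t`
  have hkey : t * ∑ i ∈ T, wt i yb < ∑ i ∈ T, wt i yb * f yb (y i) := by
    have hpos : 0 < ∑ i ∈ T, wt i yb * (f yb (y i) - t) := by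
      obtain ⟨i₀, hi₀, hzi₀⟩ := hcov yb hybK
      refine Finset.sum_pos' (fun i hi => ?_) ⟨i₀, hi₀, ?_⟩
      · rcases (hwt_nonneg i yb).eq_or_lt with h0 | hpos
        · rw [← h0, zero_mul]
        · exact mul_nonneg hpos.le
            (sub_nonneg.2 (hprop i (hTK i hi) yb hybK ((hwt_pos_iff i yb).1 hpos)).le)
      · exact mul_pos ((hwt_pos_iff i₀ yb).2 hzi₀)
          (sub_pos.2 (hprop i₀ (hTK i₀ hi₀) yb hybK hzi₀))
    have hexp : ∑ i ∈ T, wt i yb * (f yb (y i) - t)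
        = ∑ i ∈ T, wt i yb * f yb (y i) - t * ∑ i ∈ T, wt i yb := by
      rw [Finset.mul_sum, ← Finset.sum_sub_distrib]
      exact Finset.sum_congr rfl fun i _ => by ring
    linarith
  have hgt : t < T.centerMass (fun i => wt i yb) (f yb ∘ y) := by
    have hS := hsum_pos yb hybK
    simp only [Finset.centerMass, smul_eq_mul, Function.comp]
    calc t = (∑ i ∈ T, wt i yb)⁻¹ * (t * ∑ i ∈ T, wt i yb) := by
            rw [mul_comm t, ← mul_assoc, inv_mul_cancel₀ hS.ne', one_mul]
      _ < (∑ i ∈ T, wt i yb)⁻¹ * ∑ i ∈ T, wt i yb * f yb (y i) :=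
            mul_lt_mul_of_pos_left hkey (inv_pos.2 hS)
  have := ht yb hybK
  linarith
#harness_tags exists_forall_le

/-- **Ky Fan's Inequality, normalised form**: if moreover `f y y ≤ 0` on the diagonal then
`∃ x̄ ∈ K, ∀ y ∈ K, f x̄ y ≤ 0`. [cite: Aubin1993, Thm 8.6 (Ky Fan's Inequality)] -/
theorem exists_forall_le_zero {K : Set X} (hKc : IsCompact K) (hKconv : Convex ℝ K)
    (hKne : K.Nonempty) {f : X → X → ℝ} (hlsc : ∀ y ∈ K, LowerSemicontinuousOn (fun x => f x y) K)
    (hconc : ∀ x ∈ K, ConcaveOn ℝ K (f x)) (h0 : ∀ y ∈ K, f y y ≤ 0) :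
    ∃ x ∈ K, ∀ y ∈ K, f x y ≤ 0 :=
  exists_forall_le hKc hKconv hKne hlsc hconc h0
#harness_tags exists_forall_le_zero

/-! ## von Neumann's minimax theorem -/

section VonNeumann

variable {Y : Type*} [NormedAddCommGroup Y] [NormedSpace ℝ Y]

/-- **von Neumann's minimax theorem (Aubin Thm 8.2)** in real normed spaces: `E ⊆ X`, `F ⊆ Y` nonempty
convex compact, `f : X → Y → ℝ` with `x ↦ f x y` convex and lower semicontinuous on `E` (`y ∈ F`) and
`y ↦ f x y` concave and upper semicontinuous on `F` (`x ∈ E`). Then `f` has a saddle point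
`(x̄, ȳ) ∈ E × F`: `f x̄ y ≤ f x̄ ȳ ≤ f x ȳ` for all `x ∈ E`, `y ∈ F`. Proof: Ky Fan's inequality on
`E ×ˢ F` for `φ (x,y) (x',y') := f x y' - f x' y`. [cite: Aubin1993, Thm 8.2 (von Neumann)] -/
theorem exists_isSaddlePoint {E : Set X} {F : Set Y} (hEc : IsCompact E) (hEconv : Convex ℝ E)
    (hEne : E.Nonempty) (hFc : IsCompact F) (hFconv : Convex ℝ F) (hFne : F.Nonempty)
    {f : X → Y → ℝ} (hlsc : ∀ y ∈ F, LowerSemicontinuousOn (fun x => f x y) E)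
    (hconv : ∀ y ∈ F, ConvexOn ℝ E (fun x => f x y))
    (husc : ∀ x ∈ E, UpperSemicontinuousOn (f x) F) (hconc : ∀ x ∈ E, ConcaveOn ℝ F (f x)) :
    ∃ a ∈ E, ∃ b ∈ F, (∀ x ∈ E, f a b ≤ f x b) ∧ ∀ y ∈ F, f a y ≤ f a b := by
  set K : Set (X × Y) := E ×ˢ F with hK
  have hKc : IsCompact K := hEc.prod hFc
  have hKconv : Convex ℝ K := hEconv.prod hFconv
  have hKne : K.Nonempty := hEne.prod hFne
  set φ : X × Y → X × Y → ℝ := fun p q => f p.1 q.2 - f q.1 p.2 with hφ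
  -- lower semicontinuity of `p ↦ φ p q` on `K`
  have hlsc' : ∀ q ∈ K, LowerSemicontinuousOn (fun p => φ p q) K := by
    rintro q ⟨hq1, hq2⟩ p ⟨hp1, hp2⟩
    have h1 : LowerSemicontinuousWithinAt (fun p : X × Y => f p.1 q.2) K p := by
      intro s hs
      have hev : ∀ᶠ x' in 𝓝[E] p.1, s < f x' q.2 := (hlsc q.2 hq2 p.1 hp1) s hs
      exact (continuous_fst.continuousWithinAt.tendsto_nhdsWithin (fun r hr => hr.1)).eventually hev
    have h2 : LowerSemicontinuousWithinAt (fun p : X × Y => -f q.1 p.2) K p := by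
      intro s hs
      have hev : ∀ᶠ y' in 𝓝[F] p.2, f q.1 y' < -s :=
        (husc q.1 hq1 p.2 hp2) (-s) (by linarith)
      have := (continuous_snd.continuousWithinAt.tendsto_nhdsWithin
        (fun r (hr : r ∈ K) => hr.2)).eventually hev
      exact this.mono fun r hr => by dsimp only at hr ⊢; linarith
    simpa only [hφ, sub_eq_add_neg] using h1.add h2
  -- concavity of `q ↦ φ p q` on `K`
  have hconc' : ∀ p ∈ K, ConcaveOn ℝ K (φ p) := by
    rintro p ⟨hp1, hp2⟩
    have h1 : ConcaveOn ℝ K (fun q : X × Y => f p.1 q.2) := by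
      have := (hconc p.1 hp1).comp_linearMap (LinearMap.snd ℝ X Y)
      exact this.subset (fun q hq => hq.2) hKconv
    have h2 : ConvexOn ℝ K (fun q : X × Y => f q.1 p.2) :=
      ((hconv p.2 hp2).comp_linearMap (LinearMap.fst ℝ X Y)).subset (fun q hq => hq.1) hKconv
    exact h1.sub h2
  have hdiag : ∀ q ∈ K, φ q q ≤ 0 := fun q _ => by simp [hφ]
  obtain ⟨⟨a, b⟩, ⟨ha, hb⟩, hab⟩ := exists_forall_le_zero hKc hKconv hKne hlsc' hconc' hdiag
  refine ⟨a, ha, b, hb, fun x hx => ?_, fun y hy => ?_⟩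
  · have := hab (x, b) ⟨hx, hb⟩
    simp only [hφ] at this
    linarith
  · have := hab (a, y) ⟨ha, hy⟩
    simp only [hφ] at this
    linarith
#harness_tags exists_isSaddlePoint

end VonNeumann

/-! ## Finite matrix games (Cor 8.1) -/

section MatrixGame

variable {m n : ℕ}

/-- The expected loss of the row player in the zero-sum game with loss matrix `A` when the players
use the mixed strategies `λ ∈ Mᵐ`, `μ ∈ Mⁿ`: `Σᵢ Σⱼ λᵢ μⱼ aᵢⱼ` (Aubin (34)). [cite: Aubin1993, Ch. 8 eq.
(34) (expected loss of a zero-sum matrix game in mixed strategies)] -/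
def matrixGame (A : Matrix (Fin m) (Fin n) ℝ) (l : Fin m → ℝ) (μ : Fin n → ℝ) : ℝ :=
  ∑ i, ∑ j, l i * μ j * A i j
#harness_tags matrixGame

/-- `matrixGame A · μ` is affine (indeed linear) in the row strategy. [folklore] -/
private theorem matrixGame_left_affine (A : Matrix (Fin m) (Fin n) ℝ) (μ : Fin n → ℝ)
    (l₁ l₂ : Fin m → ℝ) (a b : ℝ) :
    matrixGame A (a • l₁ + b • l₂) μ = a * matrixGame A l₁ μ + b * matrixGame A l₂ μ := by
  simp only [matrixGame, Pi.add_apply, Pi.smul_apply, smul_eq_mul, Finset.mul_sum,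
    ← Finset.sum_add_distrib]
  exact Finset.sum_congr rfl fun i _ => Finset.sum_congr rfl fun j _ => by ring
#harness_tags matrixGame_left_affine

/-- `matrixGame A λ ·` is affine (indeed linear) in the column strategy. [folklore] -/
private theorem matrixGame_right_affine (A : Matrix (Fin m) (Fin n) ℝ) (l : Fin m → ℝ)
    (μ₁ μ₂ : Fin n → ℝ) (a b : ℝ) :
    matrixGame A l (a • μ₁ + b • μ₂) = a * matrixGame A l μ₁ + b * matrixGame A l μ₂ := by
  simp only [matrixGame, Pi.add_apply, Pi.smul_apply, smul_eq_mul, Finset.mul_sum,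
    ← Finset.sum_add_distrib]
  exact Finset.sum_congr rfl fun i _ => Finset.sum_congr rfl fun j _ => by ring
#harness_tags matrixGame_right_affine

/-- `matrixGame A` is jointly continuous in the two mixed strategies. [folklore] -/
private theorem continuous_matrixGame (A : Matrix (Fin m) (Fin n) ℝ) :
    Continuous fun p : (Fin m → ℝ) × (Fin n → ℝ) => matrixGame A p.1 p.2 := by
  unfold matrixGame
  refine continuous_finsetSum _ fun i _ => continuous_finsetSum _ fun j _ => ?_
  exact (((continuous_apply i).comp continuous_fst).mul
    ((continuous_apply j).comp continuous_snd)).mul continuous_const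
#harness_tags continuous_matrixGame

/-- **Aubin Cor 8.1 (von Neumann 1928).** Every zero-sum game on finite strategy sets
`{1,…,m} × {1,…,n}` (`m, n ≥ 1`) with loss matrix `A` has a saddle point in mixed strategies:
`λ̄ ∈ Mᵐ`, `μ̄ ∈ Mⁿ` (standard simplices) with
`matrixGame A λ̄ μ ≤ matrixGame A λ̄ μ̄ ≤ matrixGame A λ μ̄` for all mixed strategies `λ`, `μ`.
(The value form of the finite min-max theorem is the tree's `MinMax.exists_mixed_of_forall_mixed`;
this is the saddle-point form, as a corollary of the general Theorem 8.2.)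
[cite: Aubin1993, Cor 8.1] -/
theorem exists_isSaddlePoint_matrixGame [NeZero m] [NeZero n] (A : Matrix (Fin m) (Fin n) ℝ) :
    ∃ l ∈ stdSimplex ℝ (Fin m), ∃ μ ∈ stdSimplex ℝ (Fin n),
      (∀ l' ∈ stdSimplex ℝ (Fin m), matrixGame A l μ ≤ matrixGame A l' μ) ∧
      ∀ μ' ∈ stdSimplex ℝ (Fin n), matrixGame A l μ' ≤ matrixGame A l μ := by
  have hcont := continuous_matrixGame A
  refine exists_isSaddlePoint (isCompact_stdSimplex ℝ (Fin m)) (convex_stdSimplex ℝ (Fin m))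
    ⟨_, ite_eq_mem_stdSimplex ℝ (0 : Fin m)⟩ (isCompact_stdSimplex ℝ (Fin n))
    (convex_stdSimplex ℝ (Fin n)) ⟨_, ite_eq_mem_stdSimplex ℝ (0 : Fin n)⟩ (f := matrixGame A)
    ?_ ?_ ?_ ?_
  · intro μ _
    have h : Continuous fun l : Fin m → ℝ => matrixGame A l μ := by
      simpa only [Function.comp_def] using hcont.comp (Continuous.prodMk_left μ)
    exact h.lowerSemicontinuous.lowerSemicontinuousOn _
  · intro μ _
    refine ⟨convex_stdSimplex ℝ (Fin m), fun l₁ _ l₂ _ a b _ _ _ => ?_⟩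
    show matrixGame A (a • l₁ + b • l₂) μ ≤ a • matrixGame A l₁ μ + b • matrixGame A l₂ μ
    rw [matrixGame_left_affine, smul_eq_mul, smul_eq_mul]
  · intro l _
    have h : Continuous fun μ : Fin n → ℝ => matrixGame A l μ := by
      simpa only [Function.comp_def] using hcont.comp (Continuous.prodMk_right l)
    exact h.upperSemicontinuous.upperSemicontinuousOn _
  · intro l _
    refine ⟨convex_stdSimplex ℝ (Fin n), fun μ₁ _ μ₂ _ a b _ _ _ => ?_⟩
    show a • matrixGame A l μ₁ + b • matrixGame A l μ₂ ≤ matrixGame A l (a • μ₁ + b • μ₂)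
    rw [matrixGame_right_affine, smul_eq_mul, smul_eq_mul]
#harness_tags exists_isSaddlePoint_matrixGame

end MatrixGame

end Literature.Analysis.Convex.KyFanInequality
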